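import Summits.Ventures.Crystal3D.Theorems.StickyWulffConstantCoaxialWallLawStdCases8
import HarnessLib

/-!
# `std_cases8` WITH PREFIX CLOSURE: the connecting word between two standard dozens runs inside the standard family
# (crux `CoaxialWallLaw`, stmt-Ventures-19481, line `WallLedgerF`; input of `class_collapse8`)

HONEST FRAMING. Venture `Summits/Ventures/Crystal3D` (cell `crystal3d-full`), helper `--supports` the crux `CoaxialWallLaw`
of `route-Ventures-StickyWulffConstant` (REGISTERED line `WallLedgerF`, skeleton `Certificates` v3, registered stub
`stub_moduleCapture`).  Rung credit only; F-C1 not moved; census-free.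

`…StdCases8.std_cases8` (19481-w1) gives, for two STANDARD frames `G, G'`, a reduced model chain `P` of `≤ 3` unit model
menu normals with `img G' = G '' (Φ_P '' D₊)` — the pull-back through `G` of the tree geodesic `reduce (v ++ u.reverse)`
between the placement words `u, v ∈ 𝒮₀ = {[], [0], [c+1], [c+1,0]}`.  This file adds the one clause `class_collapse8`
needs on top: **PREFIX CLOSURE** — every time-prefix `P.drop n` of the connecting chain ALSO lands on a standard dozen
(the eight standard dozens `star(D₊) ∪ star(D₋)` form a SUBTREE of the word tree, so geodesics between them stay inside;
kernel check `reduce_drop_placement_mem` over the `8 × 8 × 4` table).  With it the lead's minimality argument kills the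
junction cancellation in `P ++ κ₀` (a cancelling time-first letter of `P` would make `κ₀.tail` a SHORTER standard class).
* `mem_placementWords_iff` — the explicit eight-element list of placement words IS `𝒮₀`;
* `reduce_drop_placement_mem` — `reduce ((reduce (v ++ u.reverse)).drop n ++ u) ∈ 𝒮₀` for `u, v ∈ 𝒮₀`, all `n`;
* **`std_cases8_prefix`** — `std_cases8` plus `∀ n, ∃ s ∈ 𝒮₀, G '' (Φ_{P.drop n} '' D₊) = wordIso s '' D₊`;
* **`std_cases8_fw_prefix`** — the plate-system form: `img G' = img (S.Fw (P ++ κ₀))` and `∀ n, StdFrame (S.Fw (P.drop n ++ κ₀))`.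
WHAT THIS IS NOT: not `class_collapse8`, not the stub; F-C1 not moved.
-/

noncomputable section

namespace Summit.Ventures.Crystal3D.Theorems

namespace ReflWord

open Summit.Ventures.Crystal3D TailResidue
open scoped InnerProductSpace

/-! ### The placement words as a kernel list -/

/-- The family `𝒮₀` of `stdFrame_iff_exists_word` is the explicit eight-element list of placement words (for kernel checks). -/
theorem mem_placementWords_iff (s : List (Fin 4)) :
    s ∈ ([[], [0], [1], [1, 0], [2], [2, 0], [3], [3, 0]] : List (List (Fin 4))) ↔
      (s = [] ∨ s = [0] ∨ ∃ c : Fin 3, s = [c.succ] ∨ s = [c.succ, 0]) := by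
  constructor
  · intro h
    simp only [List.mem_cons, List.not_mem_nil, or_false] at h
    rcases h with rfl | rfl | rfl | rfl | rfl | rfl | rfl | rfl
    · exact Or.inl rfl
    · exact Or.inr (Or.inl rfl)
    · exact Or.inr (Or.inr ⟨0, Or.inl rfl⟩)
    · exact Or.inr (Or.inr ⟨0, Or.inr rfl⟩)
    · exact Or.inr (Or.inr ⟨1, Or.inl rfl⟩)
    · exact Or.inr (Or.inr ⟨1, Or.inr rfl⟩)
    · exact Or.inr (Or.inr ⟨2, Or.inl rfl⟩)
    · exact Or.inr (Or.inr ⟨2, Or.inr rfl⟩)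
  · rintro (rfl | rfl | ⟨c, rfl | rfl⟩)
    · decide
    · decide
    · fin_cases c <;> decide
    · fin_cases c <;> decide

/-- **The standard family is geodesically closed (kernel table)**: for placement words `u, v`, every time-prefix of the
transition word `reduce (v ++ u.reverse)`, read from the placement `u`, reduces to a placement word. -/
theorem reduce_drop_placement_mem {u v : List (Fin 4)}
    (hu : u = [] ∨ u = [0] ∨ ∃ c : Fin 3, u = [c.succ] ∨ u = [c.succ, 0])
    (hv : v = [] ∨ v = [0] ∨ ∃ c : Fin 3, v = [c.succ] ∨ v = [c.succ, 0]) (n : ℕ) :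
    ∃ s : List (Fin 4), (s = [] ∨ s = [0] ∨ ∃ c : Fin 3, s = [c.succ] ∨ s = [c.succ, 0]) ∧
      reduce ((reduce (v ++ u.reverse)).drop n ++ u) = s := by
  suffices h : reduce ((reduce (v ++ u.reverse)).drop n ++ u) ∈
      ([[], [0], [1], [1, 0], [2], [2, 0], [3], [3, 0]] : List (List (Fin 4))) from
    ⟨_, (mem_placementWords_iff _).1 h, rfl⟩
  rcases le_or_gt n 3 with hn | hn
  · have key : ∀ u' ∈ ([[], [0], [1], [1, 0], [2], [2, 0], [3], [3, 0]] : List (List (Fin 4))),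
        ∀ v' ∈ ([[], [0], [1], [1, 0], [2], [2, 0], [3], [3, 0]] : List (List (Fin 4))), ∀ m ≤ 3,
        reduce ((reduce (v' ++ u'.reverse)).drop m ++ u') ∈
          ([[], [0], [1], [1, 0], [2], [2, 0], [3], [3, 0]] : List (List (Fin 4))) := by
      decide
    exact key u ((mem_placementWords_iff u).2 hu) v ((mem_placementWords_iff v).2 hv) n hn
  · have hlen : (reduce (v ++ u.reverse)).length ≤ n := (length_reduce_placement hu hv).trans hn.le
    rw [List.drop_eq_nil_of_le hlen, List.nil_append]
    rcases hu with rfl | rfl | ⟨c, rfl | rfl⟩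
    · decide
    · decide
    · fin_cases c <;> decide
    · fin_cases c <;> decide

/-! ### `std_cases8` with prefix closure -/

/-- **`std_cases8` WITH PREFIX CLOSURE.**  For STANDARD `G, G'`: a reduced chain `P` of `≤ 3` unit model menu normals with
`img G' = G '' (Φ_P '' D₊)` AND every time-prefix `P.drop n` landing on a standard dozen:
`G '' (Φ_{P.drop n} '' D₊) = wordIso s '' D₊` for a placement word `s`. -/
theorem std_cases8_prefix {G G' : EuclideanSpace ℝ (Fin 3) ≃ₗᵢ[ℝ] EuclideanSpace ℝ (Fin 3)} (hG : StdFrame G) (hG' : StdFrame G') :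
    ∃ P : List (EuclideanSpace ℝ (Fin 3)), P.length ≤ 3 ∧
      (∀ p ∈ P, ‖p‖ = 1 ∧
        ∀ w ∈ fccSlots, ⟪w, p⟫_ℝ = 0 ∨ ⟪w, p⟫_ℝ = Real.sqrt (2 / 3) ∨ ⟪w, p⟫_ℝ = -Real.sqrt (2 / 3)) ∧
      List.IsChain (fun μ μ' : EuclideanSpace ℝ (Fin 3) => ⟪μ, μ'⟫_ℝ = 1 / 3 ∨ ⟪μ, μ'⟫_ℝ = -1 / 3) P ∧
      (G' : EuclideanSpace ℝ (Fin 3) → EuclideanSpace ℝ (Fin 3)) '' (↑fccSlots : Set (EuclideanSpace ℝ (Fin 3))) =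
        (G : EuclideanSpace ℝ (Fin 3) → EuclideanSpace ℝ (Fin 3)) ''
          ((fun x => P.foldl (fun (y : EuclideanSpace ℝ (Fin 3)) μ => y - (2 * ⟪y, μ⟫_ℝ) • μ) x) '' ↑fccSlots) ∧
      ∀ n : ℕ, ∃ s : List (Fin 4), (s = [] ∨ s = [0] ∨ ∃ c : Fin 3, s = [c.succ] ∨ s = [c.succ, 0]) ∧
        (G : EuclideanSpace ℝ (Fin 3) → EuclideanSpace ℝ (Fin 3)) ''
            ((fun x => (P.drop n).foldl (fun (y : EuclideanSpace ℝ (Fin 3)) μ => y - (2 * ⟪y, μ⟫_ℝ) • μ) x) '' ↑fccSlots) =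
          (wordIso s : EuclideanSpace ℝ (Fin 3) → EuclideanSpace ℝ (Fin 3)) '' ↑fccSlots := by
  obtain ⟨u, hu, hGu⟩ := (stdFrame_iff_exists_word G).1 hG
  obtain ⟨v, hv, hGv⟩ := (stdFrame_iff_exists_word G').1 hG'
  set O := G.trans (wordIso u).symm with hO
  have hGO : ∀ y, G (O.symm y) = wordIso u y := by
    intro y
    have h : (G.trans (wordIso u).symm) (O.symm y) = y := O.apply_symm_apply y
    rw [LinearIsometryEquiv.trans_apply] at h
    calc G (O.symm y) = wordIso u ((wordIso u).symm (G (O.symm y))) := ((wordIso u).apply_symm_apply _).symm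
      _ = wordIso u y := by rw [h]
  have hOimg : (O : EuclideanSpace ℝ (Fin 3) → EuclideanSpace ℝ (Fin 3)) '' (↑fccSlots : Set (EuclideanSpace ℝ (Fin 3))) =
      ↑fccSlots := by
    rw [hO, LinearIsometryEquiv.coe_trans, Set.image_comp, hGu, ← Set.image_comp]
    conv_rhs => rw [← Set.image_id (↑fccSlots : Set (EuclideanSpace ℝ (Fin 3)))]
    exact Set.image_congr fun x _ => by simp
  set w := reduce (v ++ u.reverse) with hw
  have hwv : ∀ y, wordIso u (wordIso w y) = wordIso v y := by
    intro y
    rw [hw, wordIso_reduce, wordIso_append, LinearIsometryEquiv.trans_apply, wordIso_reverse,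
      LinearIsometryEquiv.apply_symm_apply]
  -- the image of the conjugated word `w'` read through `G`
  have himg : ∀ w' : List (Fin 4), (G : EuclideanSpace ℝ (Fin 3) → EuclideanSpace ℝ (Fin 3)) ''
      ((fun x => (w'.map fun i => O.symm (nrmVec i)).foldl
        (fun (y : EuclideanSpace ℝ (Fin 3)) μ => y - (2 * ⟪y, μ⟫_ℝ) • μ) x) '' ↑fccSlots) =
      (wordIso (w' ++ u) : EuclideanSpace ℝ (Fin 3) → EuclideanSpace ℝ (Fin 3)) '' ↑fccSlots := by
    intro w'
    have hfold : (fun x => (w'.map fun i => O.symm (nrmVec i)).foldl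
        (fun (y : EuclideanSpace ℝ (Fin 3)) μ => y - (2 * ⟪y, μ⟫_ℝ) • μ) x) = fun x => O.symm (wordIso w' (O x)) :=
      funext fun x => (symm_wordIso_apply O w' x).symm
    rw [hfold, Set.image_image]
    have hcomp : (fun x => G (O.symm (wordIso w' (O x)))) = fun x => wordIso (w' ++ u) (O x) :=
      funext fun x => by rw [hGO, wordIso_append]; rfl
    rw [hcomp, (Set.image_image (wordIso (w' ++ u) : EuclideanSpace ℝ (Fin 3) → EuclideanSpace ℝ (Fin 3)) O _).symm, hOimg]
  refine ⟨w.map fun i => O.symm (nrmVec i), by simpa using length_reduce_placement hu hv, fun p hp => ?_,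
    isChain_map_symm_nrmVec O (isChain_reduce _), ?_, fun n => ?_⟩
  · obtain ⟨i, -, rfl⟩ := List.mem_map.1 hp
    exact symm_nrmVec_menu O hOimg i
  · rw [himg w, hGv]
    refine Set.image_congr fun x _ => ?_
    rw [wordIso_append, LinearIsometryEquiv.trans_apply, hwv]
  · obtain ⟨s, hs, hred⟩ := reduce_drop_placement_mem hu hv n
    refine ⟨s, hs, ?_⟩
    rw [← List.map_drop, himg (w.drop n)]
    have hws : wordIso (w.drop n ++ u) = wordIso s := by
      rw [← wordIso_reduce (w.drop n ++ u), hw, hred]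
    rw [hws]

/-- **`std_cases8` WITH PREFIX CLOSURE, plate-system form.**  For a class `κ₀` (unit letters) whose frame `S.Fw κ₀` is
standard and any standard `G'`: `img G' = img (S.Fw (P ++ κ₀))` with `P` a reduced chain of `≤ 3` unit model menu normals,
AND `S.Fw (P.drop n ++ κ₀)` standard for every `n` — the input of `class_collapse8` (the lead's shape answer of 08:28Z). -/
theorem std_cases8_fw_prefix (S : PlateSystem) {κ₀ : List (EuclideanSpace ℝ (Fin 3))} (hunit : ∀ μ ∈ κ₀, ‖μ‖ = 1)
    (hstd : StdFrame (S.Fw κ₀)) {G' : EuclideanSpace ℝ (Fin 3) ≃ₗᵢ[ℝ] EuclideanSpace ℝ (Fin 3)} (hG' : StdFrame G') :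
    ∃ P : List (EuclideanSpace ℝ (Fin 3)), P.length ≤ 3 ∧
      (∀ p ∈ P, ‖p‖ = 1 ∧
        ∀ w ∈ fccSlots, ⟪w, p⟫_ℝ = 0 ∨ ⟪w, p⟫_ℝ = Real.sqrt (2 / 3) ∨ ⟪w, p⟫_ℝ = -Real.sqrt (2 / 3)) ∧
      List.IsChain (fun μ μ' : EuclideanSpace ℝ (Fin 3) => ⟪μ, μ'⟫_ℝ = 1 / 3 ∨ ⟪μ, μ'⟫_ℝ = -1 / 3) P ∧
      (G' : EuclideanSpace ℝ (Fin 3) → EuclideanSpace ℝ (Fin 3)) '' (↑fccSlots : Set (EuclideanSpace ℝ (Fin 3))) =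
        (S.Fw (P ++ κ₀) : EuclideanSpace ℝ (Fin 3) → EuclideanSpace ℝ (Fin 3)) '' ↑fccSlots ∧
      ∀ n : ℕ, StdFrame (S.Fw (P.drop n ++ κ₀)) := by
  obtain ⟨P, h1, h2, h3, h4, h5⟩ := std_cases8_prefix hstd hG'
  -- `img (S.Fw (Q ++ κ₀)) = S.Fw κ₀ '' (Φ_Q '' D₊)` for any sublist of unit letters
  have key : ∀ Q : List (EuclideanSpace ℝ (Fin 3)), (∀ μ ∈ Q, ‖μ‖ = 1) →
      (S.Fw (Q ++ κ₀) : EuclideanSpace ℝ (Fin 3) → EuclideanSpace ℝ (Fin 3)) '' (↑fccSlots : Set (EuclideanSpace ℝ (Fin 3))) =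
        (S.Fw κ₀ : EuclideanSpace ℝ (Fin 3) → EuclideanSpace ℝ (Fin 3)) ''
          ((fun x => Q.foldl (fun (y : EuclideanSpace ℝ (Fin 3)) μ => y - (2 * ⟪y, μ⟫_ℝ) • μ) x) '' ↑fccSlots) := by
    intro Q hQ
    have hunit' : ∀ μ ∈ Q ++ κ₀, ‖μ‖ = 1 := by
      intro μ hμ
      rcases List.mem_append.1 hμ with hμ | hμ
      · exact hQ μ hμ
      · exact hunit μ hμ
    rw [Set.image_image]
    exact Set.image_congr fun x _ => by rw [fw_apply_eq_foldl S hunit, fw_apply_eq_foldl S hunit', List.foldl_append]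
  refine ⟨P, h1, h2, h3, ?_, fun n => ?_⟩
  · rw [h4, key P fun μ hμ => (h2 μ hμ).1]
  · obtain ⟨s, hs, himg⟩ := h5 n
    rw [stdFrame_iff_exists_word]
    refine ⟨s, hs, ?_⟩
    rw [key (P.drop n) fun μ hμ => (h2 μ (List.mem_of_mem_drop hμ)).1, himg]

end ReflWord

end Summit.Ventures.Crystal3D.Theorems

end
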